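import Mathlib

/-!
# Short-loop stack erasure of a timed closed walk

Support file for `RectilinearSuffices` / `Assembly` (route CardyBoundaryCoulombGas of
`CardyFormulaZ2`, items stmt-CriticalPhenomena-5663 / 13894): the combinatorial core of the
grid-polygon approximation of a Jordan curve (approximation of a Jordan curve by simple closed
lattice polygons, uniformly in the parametrisation).

A *timed walk* is a list of pairs `(site, time)` with strictly increasing times, consecutive
times at most `Δ` apart, and consecutive sites equal or adjacent for a relation `adj`. It is
processed against a stack: a new element whose site is not on the stack is pushed; if its site is
on the stack at an entry less than `ε` older (a *short loop*), the stack is popped down to that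
entry; the first time the site is found at an entry at least `ε` older (a *long loop*) the
procedure stops and outputs the part of the stack above and including that entry, read bottom-up
(the *cycle*), together with the stopping element. The cycle has pairwise distinct sites,
consecutive sites adjacent, consecutive times increasing by less than `ε + Δ`, its first site is
the site of the stopping element, at least `ε` older, and its last site is equal or adjacent to
it and less than `ε + Δ` older (`exists_cycle_of_timed_walk`). The algorithm lives inside the
proof (an induction on the remaining walk carrying the stack invariant); no definition is made.
For the lattice walk of a finely sampled Jordan loop the only long loop is the wrap-around, and
the cycle is a simple closed lattice polygon uniformly close to the loop in its own
parametrisation (sequel files).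
-/

namespace Summit.CriticalPhenomena.CardyFormulaZ2.Theorems

namespace ShortLoopErasure

open List

variable {α : Type*}

/-- In a top-down stack chain (each lower entry older than the one above it) every entry is at
most as recent as the top. [folklore] -/
theorem snd_le_head_of_isChain {adj : α → α → Prop} {ε Δ : ℝ} :
    ∀ {S : List (α × ℝ)}, S.IsChain (fun a b => adj b.1 a.1 ∧ b.2 < a.2 ∧ a.2 < b.2 + (ε + Δ)) →
      ∀ s ∈ S, ∀ t ∈ S.head?, s.2 ≤ t.2
  | [], _ => by simp
  | [a], _ => by simp
  | a :: b :: S, h => by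
    intro s hs t ht
    simp only [head?_cons, Option.mem_def, Option.some.injEq] at ht
    subst ht
    have hab := (isChain_cons_cons.1 h).1
    have ih := snd_le_head_of_isChain (S := b :: S) h.tail
    rcases mem_cons.1 hs with rfl | hs
    · exact le_rfl
    · exact (ih s hs b (by simp)).trans hab.2.1.le

/-- **The erasure, with its invariant.** `S` is the stack (top first; distinct sites; a top-down
chain; its top has the site of the last processed element `ℓ`, is at most as recent as `ℓ` and
less than `ε` older; its bottom is `w₀`), `W` the remaining walk (a walk chain after `ℓ`) whose
final element has the site of `w₀` and is at least `ε` later than `w₀`; everything lies in `U`.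
Then some long loop stops the procedure with a cycle `C` (bottom-up) and a stopping element `x`
as described in the module docstring. [folklore] -/
theorem exists_cycle_aux [DecidableEq α] {adj : α → α → Prop} {ε Δ : ℝ} {U : List (α × ℝ)}
    {w₀ : α × ℝ} :
    ∀ (W S : List (α × ℝ)) (ℓ : α × ℝ),
      (S.map Prod.fst).Nodup →
      S.IsChain (fun a b => adj b.1 a.1 ∧ b.2 < a.2 ∧ a.2 < b.2 + (ε + Δ)) →
      (∀ s ∈ S.head?, s.1 = ℓ.1 ∧ s.2 ≤ ℓ.2 ∧ ℓ.2 < s.2 + ε) →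
      (∀ s ∈ S, s ∈ U) → ℓ ∈ U → S.getLast? = some w₀ →
      (ℓ :: W).IsChain (fun a b => (a.1 = b.1 ∨ adj a.1 b.1) ∧ a.2 < b.2 ∧ b.2 ≤ a.2 + Δ) →
      (∀ x ∈ W, x ∈ U) → ∀ hW : W ≠ [], (W.getLast hW).1 = w₀.1 →
      ε ≤ (W.getLast hW).2 - w₀.2 →
      ∃ (C : List (α × ℝ)) (x : α × ℝ), C ≠ [] ∧ (C.map Prod.fst).Nodup ∧
        C.IsChain (fun a b => adj a.1 b.1 ∧ a.2 < b.2 ∧ b.2 < a.2 + (ε + Δ)) ∧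
        (∀ c ∈ C.head?, c.1 = x.1 ∧ ε ≤ x.2 - c.2) ∧
        (∀ c ∈ C.getLast?, (c.1 = x.1 ∨ adj c.1 x.1) ∧ c.2 < x.2 ∧ x.2 < c.2 + (ε + Δ)) ∧
        (∀ c ∈ C, c ∈ U) ∧ x ∈ U := by
  intro W
  induction W with
  | nil => intro S ℓ _ _ _ _ _ _ _ _ hW; exact absurd rfl hW
  | cons x W ih =>
    intro S ℓ hnd hchS hhead hSU hℓU hlast hch hU _ hl1 hl2
    have hℓx := (isChain_cons_cons.1 hch).1
    have hchW : (x :: W).IsChain (fun a b => (a.1 = b.1 ∨ adj a.1 b.1) ∧ a.2 < b.2 ∧ b.2 ≤ a.2 + Δ) :=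
      hch.tail
    have hxU : x ∈ U := hU x (by simp)
    -- the stack is nonempty; name its top
    obtain ⟨top, Stl, hS⟩ : ∃ top Stl, S = top :: Stl := by
      cases S with
      | nil => simp at hlast
      | cons top Stl => exact ⟨top, Stl, rfl⟩
    have htop := hhead top (by simp [hS])
    have hw₀S : w₀ ∈ S := mem_of_getLast? hlast
    -- all stack times are at most `ℓ.2 < x.2`
    have hSle : ∀ s ∈ S, s.2 ≤ ℓ.2 := fun s hs =>
      (snd_le_head_of_isChain hchS s hs top (by simp [hS])).trans htop.2.1
    -- how the hypotheses on the final element pass to `W` when it is nonempty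
    have hpass : ∀ hWne : W ≠ [], (W.getLast hWne).1 = w₀.1 ∧ ε ≤ (W.getLast hWne).2 - w₀.2 := by
      intro hWne
      rw [getLast_cons hWne] at hl1 hl2
      exact ⟨hl1, hl2⟩
    -- look for the site of `x` on the stack
    set p : α × ℝ → Bool := fun y => decide (y.1 ≠ x.1) with hp
    have hdecomp : S.takeWhile p ++ S.dropWhile p = S := takeWhile_append_dropWhile
    rcases hpop : S.dropWhile p with _ | ⟨y, S'⟩
    · -- PUSH: the site of `x` is not on the stack
      have hnot : ∀ s ∈ S, s.1 ≠ x.1 := by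
        have := dropWhile_eq_nil_iff.1 hpop
        simpa [hp] using this
      have hadj : adj top.1 x.1 := by
        rcases hℓx.1 with h | h
        · exact absurd (htop.1.trans h) (hnot top (by simp [hS]))
        · rwa [← htop.1] at h
      have hε : (0 : ℝ) < ε := by linarith [htop.2.1, htop.2.2]
      -- `W` is nonempty: the final element has the site of `w₀`, which is on the stack
      have hWne : W ≠ [] := by
        intro hW
        subst hW
        simp only [getLast_singleton] at hl1
        exact hnot w₀ hw₀S hl1.symm
      refine ih (x :: S) x ?_ ?_ ?_ ?_ hxU ?_ hchW (fun z hz => hU z (by simp [hz])) hWne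
        (hpass hWne).1 (hpass hWne).2
      · rw [map_cons, nodup_cons]
        refine ⟨fun hm => ?_, hnd⟩
        obtain ⟨s, hs, hsx⟩ := mem_map.1 hm
        exact hnot s hs hsx
      · rw [hS]
        refine isChain_cons_cons.2 ⟨⟨hadj, ?_, ?_⟩, hS ▸ hchS⟩
        · exact htop.2.1.trans_lt hℓx.2.1
        · linarith [htop.2.2, hℓx.2.2]
      · intro s hs
        simp only [head?_cons, Option.mem_def, Option.some.injEq] at hs
        subst hs
        exact ⟨rfl, le_rfl, by linarith⟩
      · intro s hs
        rcases mem_cons.1 hs with rfl | hs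
        · exact hxU
        · exact hSU s hs
      · rw [hS, getLast?_cons_cons]
        exact hS ▸ hlast
    · -- the site of `x` is on the stack, at the entry `y`
      have hy1 : y.1 = x.1 := by
        have hne : S.dropWhile p ≠ [] := by rw [hpop]; exact cons_ne_nil _ _
        have key := head_dropWhile_not p (l := S) hne
        have hy : (S.dropWhile p).head hne = y := by simp [hpop]
        rw [hy] at key
        simpa [hp] using key
      have hsuf : (y :: S') <:+ S := hpop ▸ dropWhile_suffix p
      have hyS : y ∈ S := hsuf.subset (by simp)
      rw [hpop] at hdecomp
      by_cases hshort : x.2 - y.2 < ε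
      · -- POP (short loop): continue with the stack `y :: S'`
        have hWne : W ≠ [] := by
          intro hW
          subst hW
          simp only [getLast_singleton] at hl1 hl2
          have hyw : y = w₀ := inj_on_of_nodup_map hnd hyS hw₀S (hy1.trans hl1)
          rw [hyw] at hshort
          linarith
        refine ih (y :: S') x (hnd.sublist (hsuf.sublist.map _)) (hchS.infix hsuf.isInfix) ?_
          (fun s hs => hSU s (hsuf.subset hs)) hxU ?_ hchW (fun z hz => hU z (by simp [hz])) hWne
          (hpass hWne).1 (hpass hWne).2
        · intro s hs
          simp only [head?_cons, Option.mem_def, Option.some.injEq] at hs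
          subst hs
          exact ⟨hy1, (hSle _ hyS).trans hℓx.2.1.le, by linarith⟩
        · rw [← hlast, ← hdecomp, getLast?_append_of_ne_nil _ (cons_ne_nil _ _)]
      · -- STOP (long loop): output the reversed prefix `A ++ [y]` of the stack, and `x`
        set A := S.takeWhile p with hA
        have hpre : (A ++ [y]) <+: S := ⟨S', by rw [append_assoc, singleton_append, hdecomp]⟩
        have hrev : y :: A.reverse = (A ++ [y]).reverse := by simp
        refine ⟨y :: A.reverse, x, cons_ne_nil _ _, ?_, ?_, ?_, ?_, ?_, hxU⟩
        · rw [hrev, map_reverse, nodup_reverse]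
          exact hnd.sublist (hpre.sublist.map _)
        · rw [hrev, isChain_reverse]
          exact (hchS.infix hpre.isInfix).imp fun a b h => h
        · intro c hc
          simp only [head?_cons, Option.mem_def, Option.some.injEq] at hc
          subst hc
          exact ⟨hy1, not_lt.1 hshort⟩
        · intro c hc
          -- the last entry of the cycle is the top of the stack
          have hc' : c = top := by
            rw [hrev, getLast?_reverse] at hc
            have h1 : (A ++ [y]).head? = some top := by
              obtain ⟨T, hT⟩ := hpre
              rw [hS] at hT
              cases hA' : A with
              | nil =>
                rw [hA'] at hT
                simp only [nil_append, singleton_append, cons.injEq] at hT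
                simp [hT.1]
              | cons a A' =>
                rw [hA'] at hT
                simp only [cons_append, cons.injEq] at hT
                simp [hT.1]
            rw [h1] at hc
            simpa using hc.symm
          subst hc'
          refine ⟨?_, htop.2.1.trans_lt hℓx.2.1, by linarith [htop.2.2, hℓx.2.2]⟩
          rcases hℓx.1 with h | h
          · exact Or.inl (htop.1.trans h)
          · exact Or.inr (htop.1 ▸ h)
        · intro c hc
          rcases mem_cons.1 hc with rfl | hc
          · exact hSU _ hyS
          · exact hSU _ (hpre.subset (mem_append_left _ (mem_reverse.1 hc)))

/-- **The short-loop erasure of a closed timed walk.** Let `w₀ :: W` be a timed walk — consecutive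
sites equal or `adj`-adjacent, times strictly increasing by at most `Δ` — whose final element has
the site of `w₀` and is at least `ε > 0` later than `w₀`. Then there are a *cycle* `C ≠ []` of
elements of the walk and a *stopping element* `x` of `W` such that: the sites of `C` are pairwise
distinct; consecutive elements of `C` have adjacent sites and times increasing by less than
`ε + Δ`; the first element of `C` has the site of `x` and is at least `ε` older than `x`; the
last element of `C` has a site equal or adjacent to that of `x`, is older than `x`, by less than
`ε + Δ`. [folklore] -/
theorem exists_cycle_of_timed_walk [DecidableEq α] {adj : α → α → Prop} {ε Δ : ℝ}
    {w₀ : α × ℝ} {W : List (α × ℝ)} (hε : 0 < ε)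
    (hch : (w₀ :: W).IsChain (fun a b => (a.1 = b.1 ∨ adj a.1 b.1) ∧ a.2 < b.2 ∧ b.2 ≤ a.2 + Δ))
    (hW : W ≠ []) (hl1 : (W.getLast hW).1 = w₀.1) (hl2 : ε ≤ (W.getLast hW).2 - w₀.2) :
    ∃ (C : List (α × ℝ)) (x : α × ℝ), C ≠ [] ∧ (C.map Prod.fst).Nodup ∧
      C.IsChain (fun a b => adj a.1 b.1 ∧ a.2 < b.2 ∧ b.2 < a.2 + (ε + Δ)) ∧
      (∀ c ∈ C.head?, c.1 = x.1 ∧ ε ≤ x.2 - c.2) ∧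
      (∀ c ∈ C.getLast?, (c.1 = x.1 ∨ adj c.1 x.1) ∧ c.2 < x.2 ∧ x.2 < c.2 + (ε + Δ)) ∧
      (∀ c ∈ C, c ∈ w₀ :: W) ∧ x ∈ w₀ :: W :=
  exists_cycle_aux (U := w₀ :: W) W [w₀] w₀ (by simp) (isChain_singleton _)
    (fun s hs => by
      simp only [head?_cons, Option.mem_def, Option.some.injEq] at hs
      subst hs
      exact ⟨rfl, le_rfl, by linarith⟩)
    (by simp) (by simp) (by simp) hch (fun x hx => by simp [hx]) hW hl1 hl2

/-- Along a bottom-up cycle the times increase by less than `ε + Δ` per step: the last time is at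
least the first, and exceeds it by less than `(length - 1) (ε + Δ)` as soon as there are two
elements. [folklore] -/
theorem time_span_of_isChain {adj : α → α → Prop} {ε Δ : ℝ} :
    ∀ {C : List (α × ℝ)}, C.IsChain (fun a b => adj a.1 b.1 ∧ a.2 < b.2 ∧ b.2 < a.2 + (ε + Δ)) →
      ∀ hC : C ≠ [], (C.head hC).2 ≤ (C.getLast hC).2 ∧
        (2 ≤ C.length → (C.getLast hC).2 < (C.head hC).2 + ((C.length - 1 : ℕ) : ℝ) * (ε + Δ))
  | [], _, hC => absurd rfl hC
  | [a], _, _ => by simp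
  | a :: b :: C, h, _ => by
    have hab := (isChain_cons_cons.1 h).1
    obtain ⟨h1, h2⟩ := time_span_of_isChain (C := b :: C) h.tail (cons_ne_nil _ _)
    simp only [head_cons, getLast_cons (cons_ne_nil b C), length_cons, Nat.add_sub_cancel] at h1 h2 ⊢
    refine ⟨hab.2.1.le.trans h1, fun _ => ?_⟩
    have hlen : ((C.length + 1 : ℕ) : ℝ) = (C.length : ℕ) + 1 := by push_cast; ring
    rw [hlen]
    cases C with
    | nil =>
      simp only [getLast_singleton, length_nil, Nat.cast_zero, zero_add, one_mul] at h1 h2 ⊢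
      linarith [hab.2.2]
    | cons c C' =>
      have h2' := h2 (by simp)
      simp only [length_cons] at h2'
      have hlen' : ((C'.length + 1 : ℕ) : ℝ) = (C'.length : ℕ) + 1 := by push_cast; ring
      simp only [length_cons]
      rw [hlen'] at h2' ⊢
      have hpos : (0 : ℝ) ≤ (C'.length : ℕ) := Nat.cast_nonneg _
      nlinarith [hab.2.2, hab.2.1, h2']

end ShortLoopErasure

end Summit.CriticalPhenomena.CardyFormulaZ2.Theorems
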